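import Literature.Topology.FourManifolds.TrisectionsAmbientMorseLemmas
import Literature.Topology.FourManifolds.TrisectionsSectorMorse
import HarnessLib

/-!
# Recognition of the sector clause of a Gay–Kirby trisection from ambient normal-form data

Topic `Literature/Topology/FourManifolds`; infrastructure for the fact seat
`provefact-Literature.Topology.FourManifolds.exists-14560f9fc8` (named fact (c′)
`Literature.Topology.FourManifolds.exists_stabilized_gkTrisection`), the converse companion
of `TrisectionsAmbientMorse.lean`.  Everything in this file is **proved**; no definitions, no
named facts.

After a surgery on a trisection with corners performed in normal-form (product) coordinates,
the new sectors are given as closed subsets `S ⊆ X` together with *ambient* data: normal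
coordinates `u, v`, a retraction `ρ`, corner-slice charts along the corner locus `Kc`,
half-slice charts elsewhere, and an ambient function `G` which near `Kc` has the corner form
`1 - 2uv · κ` (`κ` smooth, positive, `ρ`-invariant) and which on `S` behaves like a Morse
function adapted to the boundary.  The theorems of this file turn such data back into clause
(ii) of `Literature.Topology.FourManifolds.IsGKTrisection` for `S`:

* `CornerSliceChart.not_mem_interior_of_mem_K` — corner-locus points are not interior to `S`;
* `exists_cornerSliceAtlas_hasHandleDecomposition_of_ambient` — a corner-slice atlas `Φ`
  (corner charts shrunk into the domain of the corner form) with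
  `HasHandleDecomposition 3 ↥S c` for `Φ.chartedSpace`
  (`CornerSliceAtlas.hasHandleDecomposition_of_comp_val`; the interior points of the
  straightened structure are exactly the interior points of `S` in `X`,
  `HalfSliceChart.apply_zero_pos_iff_mem_interior`);
* `sectorClause_of_ambient` — the clause-(ii) package: `W := ↥S` compact with the handle
  decomposition, `Subtype.val` an embedding onto `S`, immersion off `Kc`, corner charts over
  `Kc`, non-interior points images of boundary points (`CornerSliceAtlas.sector_smooth_clause`).

## References

* D. Gay, R. Kirby, *Trisecting 4-manifolds*, Geom. Topol. 20 (2016) 3097–3132, Def. 1.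
  [GayKirby2016]
* J. Milnor, *Morse theory*, Ann. of Math. Studies 51 (1963), §§2–3. [Milnor1963]
-/

open scoped Manifold ContDiff Topology
open Set Function Filter

noncomputable section

namespace Literature.Topology.FourManifolds

universe u

section Recognition

variable {X : Type u} [TopologicalSpace X] [ChartedSpace (EuclideanSpace ℝ (Fin 4)) X]

/-- A point of the corner locus of a corner-slice chart is not an interior point of the set (the
points `Θ⁻¹(Θ p - t e₀)`, `t > 0` small, lie outside). [folklore] -/
theorem CornerSliceChart.not_mem_interior_of_mem_K {S Kc : Set X} {u v : X → ℝ} {π : X → X}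
    (C : CornerSliceChart S Kc u v π) {p : X} (hp : p ∈ C.Θ.source) (hpK : p ∈ Kc) :
    p ∉ interior S := by
  intro hint
  obtain ⟨h0, -⟩ := (C.mem_K_iff_apply hp).1 hpK
  set e0 : EuclideanSpace ℝ (Fin 4) := EuclideanSpace.single 0 (1:ℝ) with he0
  have hlim : Tendsto (fun t : ℝ => C.Θ p - t • e0) (𝓝[>] 0) (𝓝 (C.Θ p)) := by
    have : Continuous fun t : ℝ => C.Θ p - t • e0 := by fun_prop
    have h := this.tendsto 0
    simp only [zero_smul, sub_zero] at h
    exact h.mono_left nhdsWithin_le_nhds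
  have htgt : ∀ᶠ t in 𝓝[>] (0:ℝ), C.Θ p - t • e0 ∈ C.Θ.target :=
    hlim (C.Θ.open_target.mem_nhds (C.Θ.map_source hp))
  have hconv : Tendsto (fun t : ℝ => C.Θ.symm (C.Θ p - t • e0)) (𝓝[>] 0) (𝓝 p) := by
    have hc : ContinuousAt C.Θ.symm (C.Θ p) := C.Θ.continuousAt_symm (C.Θ.map_source hp)
    have := hc.tendsto.comp hlim
    rwa [C.Θ.left_inv hp] at this
  have hinS : ∀ᶠ t in 𝓝[>] (0:ℝ), C.Θ.symm (C.Θ p - t • e0) ∈ S :=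
    hconv (mem_interior_iff_mem_nhds.1 hint)
  obtain ⟨t, ⟨htgt', hS'⟩, ht⟩ := ((htgt.and hinS).and self_mem_nhdsWithin).exists
  have ht' : (0:ℝ) < t := ht
  have hsrc : C.Θ.symm (C.Θ p - t • e0) ∈ C.Θ.source := C.Θ.map_target htgt'
  have hQ := C.apply_mem_cornerQuadrant hsrc hS'
  rw [C.Θ.right_inv htgt'] at hQ
  have : (C.Θ p - t • e0) 0 = -t := by simp [he0, h0]
  have h1 := hQ.1
  rw [this] at h1
  linarith

variable [IsManifold (𝓡 4) ∞ X]

/-- **Recognition of the sector clause from ambient normal-form data** (atlas level).  Let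
`S ⊆ X` with corner locus `Kc`, normal data `(u, v, ρ)` with corner-slice charts at the points
of `Kc` and half-slice charts (avoiding `Kc`) at the other points of `S`, and an ambient smooth
`G : X → ℝ` such that: near `Kc`, `G = 1 - 2uv · κ` with `κ` smooth, positive and `ρ`-invariant
on an open `Oκ ⊇ Kc`; `G = 1` at the non-interior points of `S` and `G < 1` at the interior
ones; `G` is regular at the non-interior points off `Kc` and nondegenerate at its interior
critical points, of which there are `c n` of each index `n`.  Then a corner-slice atlas `Φ` of
`S` (corner charts shrunk into `Oκ`) makes `↥S` a manifold with boundary carrying a handle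
decomposition with counts `c` (`CornerSliceAtlas.hasHandleDecomposition_of_comp_val`).
[cite: GayKirby2016, Def. 1; Milnor1963, §§2–3] -/
theorem exists_cornerSliceAtlas_hasHandleDecomposition_of_ambient {S Kc : Set X}
    {u v : X → ℝ} {ρ : X → X}
    (hcd : ∀ x ∈ Kc, ∃ C : CornerSliceChart S Kc u v ρ, x ∈ C.Θ.source)
    (hhalf : ∀ p ∈ S, p ∉ Kc → ∃ D : HalfSliceChart (𝓡 4) S, p ∈ D.Θ.source ∧
      ∀ q ∈ D.Θ.source, q ∉ Kc)
    {G : X → ℝ} (hGs : ContMDiff (𝓡 4) 𝓘(ℝ, ℝ) ∞ G)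
    {κ : X → ℝ} {Oκ : Set X} (hOκ : IsOpen Oκ) (hKcO : Kc ⊆ Oκ)
    (hκs : ContMDiff (𝓡 4) 𝓘(ℝ, ℝ) ∞ κ) (hκpos : ∀ y ∈ Oκ, 0 < κ y)
    (hκρ : ∀ y ∈ Oκ, κ (ρ y) = κ y)
    (hGform : ∀ y ∈ S, y ∈ Oκ → G y = 1 - 2 * u y * v y * κ y)
    (hb1 : ∀ p ∈ S, p ∉ interior S → G p = 1)
    (hi1 : ∀ p ∈ interior S, G p < 1)
    (hb2 : ∀ p ∈ S, p ∉ interior S → p ∉ Kc → ¬ IsMCriticalPt (𝓡 4) G p)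
    (hi2 : ∀ p ∈ interior S, IsMCriticalPt (𝓡 4) G p → (mhessian (𝓡 4) G p).Nondegenerate)
    {c : ℕ → ℕ} (hc : ∀ n, (interior S ∩ criticalSetOfIndex (𝓡 4) G n).ncard = c n) :
    ∃ Φ : CornerSliceAtlas S Kc u v ρ,
      (∀ (p : ↥S) (hp : p.1 ∈ Kc), (Φ.cornerDatum p hp).Θ.source ⊆ Oκ) ∧
      (letI := Φ.chartedSpace; HasHandleDecomposition 3 ↥S c) := by
  -- ### the shrunk corner data with the corner form of `G`
  have hcorner : ∀ (p : ↥S) (hp : p.1 ∈ Kc), ∃ C' : CornerSliceChart S Kc u v ρ,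
      p.1 ∈ C'.Θ.source ∧ C'.Θ.source ⊆ Oκ ∧
      ∃ G' : EuclideanSpace ℝ (Fin 4) → ℝ, ContDiffAt ℝ ∞ G' (cornerFold (C'.Θ p.1)) ∧
        fderiv ℝ G' (cornerFold (C'.Θ p.1)) ≠ 0 ∧
        ∀ q ∈ C'.Θ.source, q ∈ S → G q = G' (cornerFold (C'.Θ q)) := by
    intro p hp
    obtain ⟨C, hpC⟩ := hcd p.1 hp
    set qp : EuclideanSpace ℝ (Fin 4) := C.Θ p.1 with hqp
    have hqp0 : qp 0 = 0 := ((C.mem_K_iff_apply hpC).1 hp).1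
    have hqp1 : qp 1 = 0 := ((C.mem_K_iff_apply hpC).1 hp).2
    -- a ball around `qp` inside the target, pulled back into `Oκ`
    set D : Set (EuclideanSpace ℝ (Fin 4)) := C.Θ.target ∩ C.Θ.symm ⁻¹' Oκ with hD
    have hDo : IsOpen D := C.Θ.continuousOn_symm.isOpen_inter_preimage C.Θ.open_target hOκ
    have hqD : qp ∈ D := ⟨C.Θ.map_source hpC, by
      show C.Θ.symm (C.Θ p.1) ∈ Oκ; rw [C.Θ.left_inv hpC]; exact hKcO hp⟩
    obtain ⟨R, hRpos, hballR⟩ := Metric.isOpen_iff.1 hDo qp hqD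
    set Ω : Set X := C.Θ.source ∩ C.Θ ⁻¹' Metric.ball qp R with hΩ
    have hΩo : IsOpen Ω := C.Θ.continuousOn.isOpen_inter_preimage C.Θ.open_source Metric.isOpen_ball
    have hpΩ : p.1 ∈ Ω :=
      ⟨hpC, by show C.Θ p.1 ∈ Metric.ball qp R; exact Metric.mem_ball_self hRpos⟩
    have hΩO : ∀ y ∈ Ω, y ∈ Oκ := by
      rintro y ⟨hysrc, hyball⟩
      have : C.Θ.symm (C.Θ y) ∈ Oκ := (hballR hyball).2
      rwa [C.Θ.left_inv hysrc] at this
    -- the restricted corner-slice chart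
    let C₁ : CornerSliceChart S Kc u v ρ :=
      { Θ := C.Θ.restrOpen Ω hΩo
        contMDiffOn_toFun := C.contMDiffOn_toFun.mono (by
          rw [OpenPartialHomeomorph.restrOpen_source]; exact inter_subset_left)
        contMDiffOn_symm := C.contMDiffOn_symm.mono (by intro z hz; exact hz.1)
        mem_iff := fun q hq => C.mem_iff q (by
          rw [OpenPartialHomeomorph.restrOpen_source] at hq; exact hq.1)
        apply_zero := fun q hq => C.apply_zero q (by
          rw [OpenPartialHomeomorph.restrOpen_source] at hq; exact hq.1)
        apply_one := fun q hq => C.apply_one q (by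
          rw [OpenPartialHomeomorph.restrOpen_source] at hq; exact hq.1)
        mapsTo_π := by
          intro q hq
          rw [OpenPartialHomeomorph.restrOpen_source] at hq ⊢
          obtain ⟨hq1, hq2⟩ := hq
          have hπq : ρ q ∈ C.Θ.source := C.mapsTo_π hq1
          refine ⟨hπq, hπq, ?_⟩
          show C.Θ (ρ q) ∈ Metric.ball qp R
          rw [C.apply_π q hq1, Metric.mem_ball, dist_eq_norm]
          have hq2' : C.Θ q ∈ Metric.ball qp R := hq2.2
          rw [Metric.mem_ball, dist_eq_norm] at hq2'
          exact (norm_stratumProj_sub_le hqp0 hqp1).trans_lt hq2'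
        apply_π := fun q hq => C.apply_π q (by
          rw [OpenPartialHomeomorph.restrOpen_source] at hq; exact hq.1)
        mem_K_iff := fun q hq => C.mem_K_iff q (by
          rw [OpenPartialHomeomorph.restrOpen_source] at hq; exact hq.1) }
    have hC₁src : C₁.Θ.source = Ω := by
      show (C.Θ.restrOpen Ω hΩo).source = Ω
      rw [OpenPartialHomeomorph.restrOpen_source, hΩ, ← inter_assoc, inter_self]
    have hC₁coe : ∀ q, C₁.Θ q = C.Θ q := fun q => rfl
    -- the corner form `G' x = 1 - x₀ · κ (Θ⁻¹ (stratumProj x))`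
    set κh : EuclideanSpace ℝ (Fin 4) → ℝ := fun x => κ (C.Θ.symm (stratumProj x)) with hκh
    set G' : EuclideanSpace ℝ (Fin 4) → ℝ := fun x => 1 - x 0 * κh x with hG'
    have hxp : cornerFold qp = qp := by
      ext i'; fin_cases i' <;> simp [cornerFold, hqp0, hqp1]
    have hsPqp : stratumProj qp = qp := stratumProj_eq_self hqp0 hqp1
    have hκhs : ContDiffAt ℝ ∞ κh qp := by
      have h1 : ContMDiffOn 𝓘(ℝ, EuclideanSpace ℝ (Fin 4)) 𝓘(ℝ, ℝ) ∞ (κ ∘ C.Θ.symm) C.Θ.target :=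
        hκs.comp_contMDiffOn C.contMDiffOn_symm
      have h2 : ContDiffOn ℝ ∞ (κ ∘ C.Θ.symm) C.Θ.target := contMDiffOn_iff_contDiffOn.mp h1
      have h3 : ContDiffAt ℝ ∞ (κ ∘ C.Θ.symm) (stratumProj qp) := by
        rw [hsPqp]; exact h2.contDiffAt (C.Θ.open_target.mem_nhds (C.Θ.map_source hpC))
      exact h3.comp qp contDiff_stratumProj.contDiffAt
    have hG's : ContDiffAt ℝ ∞ G' qp :=
      contDiffAt_const.sub ((contDiffAt_piLp_apply (p := 2) (i := (0 : Fin 4))).mul hκhs)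
    have hG'd : fderiv ℝ G' qp ≠ 0 := by
      have hκd := (hκhs.differentiableAt (by simp)).hasFDerivAt
      have hprod : HasFDerivAt (fun x : EuclideanSpace ℝ (Fin 4) => x 0 * κh x)
          (qp 0 • fderiv ℝ κh qp + κh qp • EuclideanSpace.proj (𝕜 := ℝ) (0 : Fin 4)) qp :=
        ((EuclideanSpace.proj (𝕜 := ℝ) (0 : Fin 4)).hasFDerivAt).mul hκd
      have hG'fd : HasFDerivAt G'
          (0 - (qp 0 • fderiv ℝ κh qp + κh qp • EuclideanSpace.proj (𝕜 := ℝ) (0 : Fin 4))) qp :=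
        (hasFDerivAt_const (1:ℝ) qp).sub hprod
      rw [hG'fd.fderiv, hqp0, zero_smul, zero_add, zero_sub]
      intro hzero
      have := congrArg (fun L : EuclideanSpace ℝ (Fin 4) →L[ℝ] ℝ => L (EuclideanSpace.single 0 1))
        hzero
      simp only [neg_apply, smul_apply, smul_eq_mul, zero_apply] at this
      have hκqp : κh qp = κ p.1 := by
        show κ (C.Θ.symm (stratumProj qp)) = κ p.1
        rw [hsPqp, hqp, C.Θ.left_inv hpC]
      have hκp : 0 < κ p.1 := hκpos _ (hKcO hp)
      have : κh qp = 0 := by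
        have h' : κh qp *
            (EuclideanSpace.proj (𝕜 := ℝ) (0 : Fin 4) (EuclideanSpace.single 0 (1:ℝ))) = 0 := by
          linarith
        simpa using h'
      linarith [hκqp ▸ this]
    refine ⟨C₁, by rw [hC₁src]; exact hpΩ, by rw [hC₁src]; exact hΩO, G', ?_, ?_,
      fun q hq hqS => ?_⟩
    · rw [hC₁coe, ← hqp, hxp]; exact hG's
    · rw [hC₁coe, ← hqp, hxp]; exact hG'd
    · rw [hC₁src] at hq
      have hqO : q ∈ Oκ := hΩO q hq
      rw [hGform q hqS hqO, hC₁coe]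
      have hq1 : q ∈ C.Θ.source := hq.1
      have h0 : cornerFold (C.Θ q) 0 = 2 * u q * v q := by
        rw [cornerFold_apply_zero, C.apply_zero q hq1, C.apply_one q hq1]
      have hρq : κ q = κh (cornerFold (C.Θ q)) := by
        simp only [hκh, stratumProj_cornerFold]
        have := C.π_symm_eq (C.Θ.map_source hq1)
        rw [C.Θ.left_inv hq1] at this
        rw [← this, hκρ q hqO]
      show 1 - 2 * u q * v q * κ q = 1 - (cornerFold (C.Θ q)) 0 * κh (cornerFold (C.Θ q))
      rw [h0, ← hρq]
  choose C' hpC' hC'O hC'G using hcorner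
  choose Dh hpDh hDhK using hhalf
  -- ### the atlas
  let Φ : CornerSliceAtlas S Kc u v ρ :=
    { halfDatum := fun p hp => Dh p.1 p.2 hp
      half_mem_source := fun p hp => hpDh p.1 p.2 hp
      half_not_mem := fun p hp => hDhK p.1 p.2 hp
      cornerDatum := C'
      corner_mem_source := hpC' }
  -- ### interior points of the straightened structure are the interior points of `S` in `X`
  have hKint : ∀ p : ↥S, p.1 ∈ Kc → p.1 ∉ interior S := fun p hp =>
    (C' p hp).not_mem_interior_of_mem_K (hpC' p hp) hp
  have hint_iff : ∀ p : ↥S,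
      (letI := Φ.chartedSpace; (𝓡∂ 4).IsInteriorPoint p) ↔ p.1 ∈ interior S := by
    intro p
    letI := Φ.chartedSpace
    by_cases hp : p.1 ∈ Kc
    · constructor
      · intro hpint
        exact absurd (Φ.isBoundaryPoint_of_mem p hp)
          (ModelWithCorners.isInteriorPoint_iff_not_isBoundaryPoint _ |>.1 hpint)
      · intro hint; exact absurd hint (hKint p hp)
    · rw [Φ.isInteriorPoint_iff_of_not_mem p hp]
      exact (Dh p.1 p.2 hp).apply_zero_pos_iff_mem_interior (hpDh p.1 p.2 hp) p.2
  have hbd_iff : ∀ p : ↥S,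
      (letI := Φ.chartedSpace; (𝓡∂ 4).IsBoundaryPoint p) ↔ p.1 ∉ interior S := by
    intro p
    letI := Φ.chartedSpace
    rw [ModelWithCorners.isBoundaryPoint_iff_not_isInteriorPoint, hint_iff]
  -- ### the hypotheses of `hasHandleDecomposition_of_comp_val`
  refine ⟨Φ, fun p hp => hC'O p hp, ?_⟩
  refine Φ.hasHandleDecomposition_of_comp_val (F := G) (fun q _ _ => hGs.contMDiffAt)
    (fun p hp => hC'G p hp) (fun p hpb => hb1 p.1 p.2 ((hbd_iff p).1 hpb))
    (fun p hpb hpK => hb2 p.1 p.2 ((hbd_iff p).1 hpb) hpK)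
    (fun p hpi => hi1 p.1 ((hint_iff p).1 hpi))
    (fun p hpi hcrit => hi2 p.1 ((hint_iff p).1 hpi) hcrit) (fun n => ?_)
  -- counts
  letI := Φ.chartedSpace
  have hset : (Subtype.val : ↥S → X) '' ((𝓡∂ 4).interior ↥S) = interior S := by
    ext y
    constructor
    · rintro ⟨p, hp, rfl⟩
      exact (hint_iff p).1 hp
    · intro hy
      refine ⟨⟨y, interior_subset hy⟩, ?_, rfl⟩
      exact (hint_iff ⟨y, interior_subset hy⟩).2 hy
  rw [hset, hc n]

/-- **Recognition of the sector clause from ambient normal-form data** (the clause-(ii)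
package).  Under the hypotheses of
`exists_cornerSliceAtlas_hasHandleDecomposition_of_ambient`, for `S` compact: the data of
clause (ii) of `Literature.Topology.FourManifolds.IsGKTrisection` for the set `S` with corner
locus `Kc` — a compact `C^∞` manifold with boundary `W` (namely `↥S` with the straightened
structure) with a handle decomposition with counts `c`, embedded onto `S`, an immersion off `Kc`
with corner charts over `Kc`, whose boundary points map onto the non-interior points of `S`
(connectedness is left to the caller). [cite: GayKirby2016, Def. 1] -/
theorem sectorClause_of_ambient {S Kc : Set X} (hSc : IsCompact S)
    {u v : X → ℝ} {ρ : X → X}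
    (hcd : ∀ x ∈ Kc, ∃ C : CornerSliceChart S Kc u v ρ, x ∈ C.Θ.source)
    (hhalf : ∀ p ∈ S, p ∉ Kc → ∃ D : HalfSliceChart (𝓡 4) S, p ∈ D.Θ.source ∧
      ∀ q ∈ D.Θ.source, q ∉ Kc)
    {G : X → ℝ} (hGs : ContMDiff (𝓡 4) 𝓘(ℝ, ℝ) ∞ G)
    {κ : X → ℝ} {Oκ : Set X} (hOκ : IsOpen Oκ) (hKcO : Kc ⊆ Oκ)
    (hκs : ContMDiff (𝓡 4) 𝓘(ℝ, ℝ) ∞ κ) (hκpos : ∀ y ∈ Oκ, 0 < κ y)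
    (hκρ : ∀ y ∈ Oκ, κ (ρ y) = κ y)
    (hGform : ∀ y ∈ S, y ∈ Oκ → G y = 1 - 2 * u y * v y * κ y)
    (hb1 : ∀ p ∈ S, p ∉ interior S → G p = 1)
    (hi1 : ∀ p ∈ interior S, G p < 1)
    (hb2 : ∀ p ∈ S, p ∉ interior S → p ∉ Kc → ¬ IsMCriticalPt (𝓡 4) G p)
    (hi2 : ∀ p ∈ interior S, IsMCriticalPt (𝓡 4) G p → (mhessian (𝓡 4) G p).Nondegenerate)
    {c : ℕ → ℕ} (hc : ∀ n, (interior S ∩ criticalSetOfIndex (𝓡 4) G n).ncard = c n) :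
    ∃ (W : Type u) (_ : TopologicalSpace W) (_ : ChartedSpace (EuclideanHalfSpace 4) W)
      (e : W → X), IsManifold (𝓡∂ 4) ∞ W ∧ CompactSpace W ∧
      HasHandleDecomposition 3 W c ∧ Topology.IsEmbedding e ∧ range e = S ∧
      (∀ w, e w ∉ Kc → Manifold.IsImmersionAt (𝓡∂ 4) (𝓡 4) ∞ e w) ∧
      (∀ w, e w ∈ Kc → IsCornerAt e w) ∧
      (∀ y ∈ S, y ∉ interior S → y ∈ e '' (𝓡∂ 4).boundary W) := by
  obtain ⟨Φ, -, hHD⟩ := exists_cornerSliceAtlas_hasHandleDecomposition_of_ambient hcd hhalf hGs hOκ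
    hKcO hκs hκpos hκρ hGform hb1 hi1 hb2 hi2 hc
  letI := Φ.chartedSpace
  obtain ⟨hM, hemb, hrange, himm, hcor, hKbd⟩ := Φ.sector_smooth_clause
  haveI : CompactSpace ↥S := isCompact_iff_compactSpace.1 hSc
  refine ⟨↥S, inferInstance, Φ.chartedSpace, Subtype.val, hM, inferInstance, hHD, hemb, hrange,
    himm, hcor, fun y hyS hyint => ?_⟩
  refine ⟨⟨y, hyS⟩, ?_, rfl⟩
  by_cases hyK : y ∈ Kc
  · exact hKbd ⟨y, hyS⟩ hyK
  · show (𝓡∂ 4).IsBoundaryPoint (⟨y, hyS⟩ : ↥S)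
    rw [ModelWithCorners.isBoundaryPoint_iff_not_isInteriorPoint,
      Φ.isInteriorPoint_iff_of_not_mem ⟨y, hyS⟩ hyK,
      (Φ.halfDatum ⟨y, hyS⟩ hyK).apply_zero_pos_iff_mem_interior (Φ.half_mem_source _ hyK) hyS]
    exact hyint

end Recognition

end Literature.Topology.FourManifolds
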